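import Summits.Parity.BatemanHorn.Theorems.SoloInformedThinShortInterval
import HarnessLib

/-!
# Thin sequences vs. Type-I/II information, XIII: short intervals with a modulus

`SoloInformedThinShortInterval` treats Ford–Maynard's comparison sequences with `q = 1`.  Their
Lemma 4.6 uses, for a modulus `q ≤ x²` and `y ≤ x/2`, the sequence
`b_n = (xq/2)/(yφ(q)) · 1_{x − y < n ≤ x, (n, q) = 1}` (written below as an `if` over the three
conditions).  For every `p` coprime to `q` with `2pq ≤ y` it puts mass `≥ x/(4p)` on the
multiples of `p` in `(x/2, x]`: the cofactors fill an interval of length `≥ y/p − 1`, and any `q`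
consecutive integers contain exactly `φ(q)` integers coprime to `q`.  Feeding this into the local
forms with the exceptional set "primes dividing `q`" (`…_coprime_local`) gives, UNCONDITIONALLY in
`b`: a support of size `x^{1−c}` carries no Type-II information in any window `[θ, θ + ν]` with
`θ + η < c` and no Type-I information at any level `γ > 1 − c + η`, relative to FM's `q`-twisted
short-interval sequence, for every `q ≥ 1` and `y ≤ x/2` with `2 x^κ q ≤ y` (`κ > θ`, resp.
`κ > 1 − c + η`, free) and height `x^{1−η} q ≤ 2 y φ(q)`.

* `card_filter_coprime_Ico_blocks` — `k` blocks of `q` consecutive integers contain `k φ(q)`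
  integers coprime to `q`;
* `shortIntervalQ_mass`, `shortIntervalQ_height` — bookkeeping for `b`;
* `eventually_not_typeII_shortInterval_coprime`, `eventually_not_typeI_shortInterval_coprime`.

References: [cite: FordMaynard2024PrimeSieves, §4.2 (Lemma 4.6)]
[cite: FordMaynard2024PrimeSieves, §2.4] [cite: FordMaynard2024PrimeSieves, §1 (I), (II)].
-/

noncomputable section

open Filter Finset Real

namespace Summit.Parity.BatemanHorn.Theorems

open Literature.Barriers.Parity.FordMaynard (TypeI TypeII)

/-- `k` consecutive blocks of `q` integers contain exactly `k φ(q)` integers coprime to `q`.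
[folklore] -/
theorem card_filter_coprime_Ico_blocks (q a k : ℕ) :
    ((Ico a (a + k * q)).filter (fun n : ℕ => q.Coprime n)).card = k * q.totient := by
  induction k with
  | zero => simp
  | succ k ih =>
    have e : a + (k + 1) * q = a + k * q + q := by ring
    rw [e, ← Finset.Ico_union_Ico_eq_Ico (Nat.le_add_right a (k * q))
      (Nat.le_add_right (a + k * q) q), filter_union,
      card_union_of_disjoint (disjoint_filter_filter (Ico_disjoint_Ico_consecutive _ _ _)),
      ih, Nat.filter_coprime_Ico_eq_totient q (a + k * q)]
    ring

/-- Ford–Maynard's comparison sequence `b_n = (xq/2)/(yφ(q)) · 1_{x − y < n ≤ x, (n,q)=1}`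
(Lemma 4.6, general modulus `q`) puts mass `≥ x/(4p)` on the multiples in `(x/2, x]` of every
`p` coprime to `q` with `2pq ≤ y`, for `y ≤ x/2`: the cofactor interval has length `≥ y/p − 1` and
any `q` consecutive integers contain `φ(q)` integers coprime to `q`.
[cite: FordMaynard2024PrimeSieves, §4.2 (Lemma 4.6)] -/
theorem shortIntervalQ_mass {x y : ℝ} {p q : ℕ} (hp : 0 < p) (hq : 0 < q)
    (hpq : Nat.Coprime p q) (hpy : 2 * (p : ℝ) * q ≤ y) (hyx : y ≤ x / 2) :
    x / (4 * p) ≤ ∑ n ∈ (Icc 1 ⌊x⌋₊).filter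
      (fun n : ℕ => x / 2 < (p * n : ℝ) ∧ (p * n : ℝ) ≤ x),
        (if x - y < ((p * n : ℕ) : ℝ) ∧ ((p * n : ℕ) : ℝ) ≤ x ∧ Nat.Coprime (p * n) q
          then x * q / (2 * y * (q.totient : ℝ)) else 0) := by
  have hp' : (0 : ℝ) < p := by exact_mod_cast hp
  have hq' : (0 : ℝ) < q := by exact_mod_cast hq
  have hy0 : 0 ≤ y := le_trans (by positivity) hpy
  have hx : 0 ≤ x := by linarith
  have hφ : (0 : ℝ) < (q.totient : ℝ) := by exact_mod_cast Nat.totient_pos.mpr hq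
  have hv : 0 ≤ x * q / (2 * y * (q.totient : ℝ)) := by positivity
  set A : ℕ := ⌊(x - y) / p⌋₊ with hA
  set Bn : ℕ := ⌊x / p⌋₊ with hBn
  set k : ℕ := (Bn - A) / q with hk
  set m : ℕ := k * q with hm
  have hmD : m ≤ Bn - A := by rw [hm, hk]; exact Nat.div_mul_le_self _ _
  set Jc : Finset ℕ := (Ico (A + 1) (A + 1 + m)).filter (fun n : ℕ => q.Coprime n) with hJc
  set F : Finset ℕ := (Icc 1 ⌊x⌋₊).filter
    (fun n : ℕ => x / 2 < (p * n : ℝ) ∧ (p * n : ℝ) ≤ x) with hF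
  have hJcJ : ∀ n ∈ Jc, n ∈ Ioc A Bn := by
    intro n hn
    rw [hJc, mem_filter, mem_Ico] at hn
    rw [mem_Ioc]
    omega
  have hJcF : Jc ⊆ F := by
    intro n hn
    obtain ⟨h1, h2, h3, h4⟩ := mem_Ioc_short hy0 hyx hp (hJcJ n hn)
    rw [hF, mem_filter, mem_Icc]
    exact ⟨⟨h1, h2⟩, by linarith, h4⟩
  have hval : ∀ n ∈ Jc, (if x - y < ((p * n : ℕ) : ℝ) ∧ ((p * n : ℕ) : ℝ) ≤ x ∧
      Nat.Coprime (p * n) q then x * q / (2 * y * (q.totient : ℝ)) else 0) =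
      x * q / (2 * y * (q.totient : ℝ)) := by
    intro n hn
    obtain ⟨_, _, h3, h4⟩ := mem_Ioc_short hy0 hyx hp (hJcJ n hn)
    have hnq : Nat.Coprime n q := by
      rw [hJc, mem_filter] at hn; exact hn.2.symm
    rw [if_pos]
    refine ⟨?_, ?_, Nat.coprime_mul_iff_left.mpr ⟨hpq, hnq⟩⟩
    · push_cast; exact h3
    · push_cast; exact h4
  have hsub : ∑ n ∈ Jc, (if x - y < ((p * n : ℕ) : ℝ) ∧ ((p * n : ℕ) : ℝ) ≤ x ∧
      Nat.Coprime (p * n) q then x * q / (2 * y * (q.totient : ℝ)) else 0) ≤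
      ∑ n ∈ F, (if x - y < ((p * n : ℕ) : ℝ) ∧ ((p * n : ℕ) : ℝ) ≤ x ∧
      Nat.Coprime (p * n) q then x * q / (2 * y * (q.totient : ℝ)) else 0) :=
    sum_le_sum_of_subset_of_nonneg hJcF (fun n _ _ => by split_ifs <;> [exact hv; exact le_rfl])
  rw [sum_congr rfl hval, sum_const, nsmul_eq_mul] at hsub
  have hcardJc : (Jc.card : ℝ) = k * (q.totient : ℝ) := by
    rw [hJc, hm, card_filter_coprime_Ico_blocks]; push_cast; ring
  -- `k q ≥ (Bn − A) + 1 − q ≥ y/p − q`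
  have hBA : y / p - 1 ≤ ((Bn - A : ℕ) : ℝ) := by
    have := sub_one_le_card_Ioc_short hy0 hyx hp
    rwa [Nat.card_Ioc] at this
  have hlt : Bn - A < (Bn - A) / q * q + q := Nat.lt_div_mul_add hq
  have hle' : (Bn - A) + 1 ≤ m + q := by rw [hm, hk]; omega
  have hmq : ((Bn - A : ℕ) : ℝ) + 1 ≤ (m : ℝ) + q := by exact_mod_cast hle'
  have hmr : (m : ℝ) = (k : ℝ) * q := by rw [hm]; push_cast; ring
  have hKq : y / p - q ≤ (k : ℝ) * q := by linarith
  have hxy : 0 ≤ x / (2 * y) := by positivity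
  have hy' : 0 < y := by
    have : (0 : ℝ) < 2 * p * q := by positivity
    linarith
  have h3 : (Jc.card : ℝ) * (x * q / (2 * y * (q.totient : ℝ))) =
      (k : ℝ) * q * (x / (2 * y)) := by
    rw [hcardJc]; field_simp
  have h5 : (y / p - q) * (x / (2 * y)) ≤ (k : ℝ) * q * (x / (2 * y)) :=
    mul_le_mul_of_nonneg_right hKq hxy
  have h6 : (y / p - q) * (x / (2 * y)) = x / (2 * p) - q * x / (2 * y) := by
    field_simp
  have h7 : q * x / (2 * y) ≤ x / (4 * p) := by
    rw [div_le_div_iff₀ (by positivity) (by positivity)]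
    have := mul_le_mul_of_nonneg_left hpy hx
    nlinarith
  have h8 : x / (2 * p) = 2 * (x / (4 * p)) := by
    field_simp
    try ring
  linarith

/-- Height of Ford–Maynard's comparison sequence: `0 ≤ b_n ≤ x^η` once
`x^{1−η} q ≤ 2 y φ(q)`. -/
theorem shortIntervalQ_height {x y η : ℝ} {q : ℕ} (hx : 0 < x) (hy : 0 < y) (hq : 0 < q)
    (hh : x ^ (1 - η) * q ≤ 2 * y * (q.totient : ℝ)) (m : ℕ) :
    0 ≤ (if x - y < (m : ℝ) ∧ (m : ℝ) ≤ x ∧ Nat.Coprime m q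
        then x * q / (2 * y * (q.totient : ℝ)) else 0) ∧
      (if x - y < (m : ℝ) ∧ (m : ℝ) ≤ x ∧ Nat.Coprime m q
        then x * q / (2 * y * (q.totient : ℝ)) else 0) ≤ x ^ η := by
  have hφ : (0 : ℝ) < (q.totient : ℝ) := by exact_mod_cast Nat.totient_pos.mpr hq
  have hv : 0 ≤ x * q / (2 * y * (q.totient : ℝ)) := by positivity
  have hle : x * q / (2 * y * (q.totient : ℝ)) ≤ x ^ η := by
    rw [div_le_iff₀ (by positivity)]
    have h1 : x = x ^ (1 - η) * x ^ η := by
      rw [← Real.rpow_add hx]; norm_num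
    have h2 := mul_le_mul_of_nonneg_left hh (Real.rpow_nonneg hx.le η)
    calc x * q = (x ^ (1 - η) * x ^ η) * q := by rw [← h1]
      _ = x ^ η * (x ^ (1 - η) * q) := by ring
      _ ≤ x ^ η * (2 * y * (q.totient : ℝ)) := h2
  split_ifs
  · exact ⟨hv, hle⟩
  · exact ⟨le_rfl, Real.rpow_nonneg hx.le _⟩

/-- **Short intervals with a modulus, Type II.**  Let `0 ≤ θ < κ`, `0 ≤ η`, `θ + η < c ≤ 1`,
`ν > 0`, `B > 1`.  For all large `x`, every real `a` with at most `x^{1−c}` non-zero values on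
`(x/2, x]`, every modulus `q ≥ 1` and every `y ≤ x/2` with `2 x^κ q ≤ y` and height
`x^{1−η} q ≤ 2 y φ(q)`: `w = a − b` violates (II) in `[θ, θ + ν]` for Ford–Maynard's comparison
sequence `b_n = (xq/2)/(yφ(q)) · 1_{x−y<n≤x, (n,q)=1}` (Lemma 4.6) — unconditionally in `b`.
[cite: FordMaynard2024PrimeSieves, §2.4] [cite: FordMaynard2024PrimeSieves, §4.2 (Lemma 4.6)] -/
theorem eventually_not_typeII_shortInterval_coprime {c θ ν B η κ : ℝ} (hθ : 0 ≤ θ) (hη : 0 ≤ η)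
    (hθc : θ + η < c) (hc1 : c ≤ 1) (hν : 0 < ν) (hB : 1 < B) (hκ : θ < κ) :
    ∀ᶠ x : ℝ in atTop, ∀ (a : ℕ → ℝ) (A : Finset ℕ) (y : ℝ) (q : ℕ), (A.card : ℝ) ≤ x ^ (1 - c) →
      (∀ v : ℕ, x / 2 < (v : ℝ) → (v : ℝ) ≤ x → a v ≠ 0 → v ∈ A) → 0 < q →
      x ^ (1 - η) * q ≤ 2 * y * (q.totient : ℝ) → 2 * x ^ κ * q ≤ y → y ≤ x / 2 →
      ¬ TypeII (fun n : ℕ => a n - (if x - y < (n : ℝ) ∧ (n : ℝ) ≤ x ∧ Nat.Coprime n q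
        then x * q / (2 * y * (q.totient : ℝ)) else 0)) x θ ν B := by
  have hκ0 : 0 < κ := lt_of_le_of_lt hθ hκ
  filter_upwards [eventually_not_typeII_of_sparse_cmp_coprime_local hθ hη hθc hc1 hν hB hκ,
    eventually_ge_atTop (1 : ℝ)] with x hx hx1 a A y q hA hcov hq hh hqy hyx
  have hx0 : 0 < x := by linarith
  have hq1 : (1 : ℝ) ≤ q := by exact_mod_cast hq
  have hxκ : 1 ≤ x ^ κ := Real.one_le_rpow hx1 hκ0.le
  have hqκ : (q : ℝ) ≤ x ^ κ * q := le_mul_of_one_le_left (by positivity) hxκ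
  have hy0 : 0 < y := by linarith
  have hhgt := shortIntervalQ_height (η := η) hx0 hy0 hq hh
  refine hx a (fun n : ℕ => if x - y < (n : ℝ) ∧ (n : ℝ) ≤ x ∧ Nat.Coprime n q
      then x * q / (2 * y * (q.totient : ℝ)) else 0) A q hA hcov
    (fun n => (hhgt n).1) (fun n => (hhgt n).2) hq ?_ ?_
  · have hxx : x ≤ x ^ 2 := by nlinarith
    linarith
  · intro p hp hndvd _ hpκ
    have hpq : Nat.Coprime p q := (Nat.Prime.coprime_iff_not_dvd hp).mpr hndvd
    have hp2 : 2 * (p : ℝ) * q ≤ y := by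
      have : (p : ℝ) * q ≤ x ^ κ * q := mul_le_mul_of_nonneg_right hpκ (by positivity)
      linarith
    exact shortIntervalQ_mass hp.pos hq hpq hp2 hyx

/-- **Short intervals with a modulus, Type I.**  Let `0 ≤ η < c ≤ 1`, `γ > 1 − c + η`,
`κ > 1 − c + η`, `B > 1`.  For all large `x`, every real `a` with at most `x^{1−c}` non-zero
values on `(x/2, x]`, every `q ≥ 1` and `y ≤ x/2` with `2 x^κ q ≤ y`, `x^{1−η} q ≤ 2 y φ(q)`:
`w = a − b` violates (I) at level `x^γ` for `b_n = (xq/2)/(yφ(q)) · 1_{x−y<n≤x, (n,q)=1}`.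
[cite: FordMaynard2024PrimeSieves, §2.4] [cite: FordMaynard2024PrimeSieves, §4.2 (Lemma 4.6)] -/
theorem eventually_not_typeI_shortInterval_coprime {c γ B η κ : ℝ} (hη : 0 ≤ η) (hηc : η < c)
    (hc1 : c ≤ 1) (hγ : 1 - c + η < γ) (hB : 1 < B) (hκ : 1 - c + η < κ) :
    ∀ᶠ x : ℝ in atTop, ∀ (a : ℕ → ℝ) (A : Finset ℕ) (y : ℝ) (q : ℕ), (A.card : ℝ) ≤ x ^ (1 - c) →
      (∀ v : ℕ, x / 2 < (v : ℝ) → (v : ℝ) ≤ x → a v ≠ 0 → v ∈ A) → 0 < q →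
      x ^ (1 - η) * q ≤ 2 * y * (q.totient : ℝ) → 2 * x ^ κ * q ≤ y → y ≤ x / 2 →
      ¬ TypeI (fun n : ℕ => a n - (if x - y < (n : ℝ) ∧ (n : ℝ) ≤ x ∧ Nat.Coprime n q
        then x * q / (2 * y * (q.totient : ℝ)) else 0)) x γ B := by
  have hκ0 : 0 < κ := by linarith
  filter_upwards [eventually_not_typeI_of_sparse_cmp_coprime_local hη hηc hc1 hγ hB hκ,
    eventually_ge_atTop (1 : ℝ)] with x hx hx1 a A y q hA hcov hq hh hqy hyx
  have hx0 : 0 < x := by linarith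
  have hq1 : (1 : ℝ) ≤ q := by exact_mod_cast hq
  have hxκ : 1 ≤ x ^ κ := Real.one_le_rpow hx1 hκ0.le
  have hqκ : (q : ℝ) ≤ x ^ κ * q := le_mul_of_one_le_left (by positivity) hxκ
  have hy0 : 0 < y := by linarith
  have hhgt := shortIntervalQ_height (η := η) hx0 hy0 hq hh
  refine hx a (fun n : ℕ => if x - y < (n : ℝ) ∧ (n : ℝ) ≤ x ∧ Nat.Coprime n q
      then x * q / (2 * y * (q.totient : ℝ)) else 0) A q hA hcov
    (fun n => (hhgt n).1) (fun n => (hhgt n).2) hq ?_ ?_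
  · have hxx : x ≤ x ^ 2 := by nlinarith
    linarith
  · intro p hp hndvd hpκ
    have hpq : Nat.Coprime p q := (Nat.Prime.coprime_iff_not_dvd hp).mpr hndvd
    have hp2 : 2 * (p : ℝ) * q ≤ y := by
      have : (p : ℝ) * q ≤ x ^ κ * q := mul_le_mul_of_nonneg_right hpκ (by positivity)
      linarith
    exact shortIntervalQ_mass hp.pos hq hpq hp2 hyx

end Summit.Parity.BatemanHorn.Theorems

end
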